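import Summits.CriticalPhenomena.PercolationContinuityZ3.Theorems.PercNearOneGluingNoHeavyQuantCatHullCertDataR8
import HarnessLib

/-!
# QUANT lane R8, T-DEC: LEAF CHECKS of certificate `R8`, shard 2

builds on p205010 (kernel theorem, internal audit signed; external expert review pending)

Computational support file (`--supports stmt-CriticalPhenomena-4575`, `--computational`), census seat prim-quant-census-2 (gen 78): kernel
evaluation (`native_decide`) of parts of `CertData.check2` for the certificate `certDataR8` (memo
`run/shared/lean/prim/quant/prim-quant-census-2-g78/BELLMAN-G78.md`).  Heavy leaves are split into `G`-strips / sub-boxes (`…QuantCatHullLeafPieces`).  [this work].  Nothing here is cited as a published result.  The gluing rows served [cite: KozmaNitzan2024, Conjecture 3 (p. 15)]; product measure [cite: Grimmett1999, §1.3 p. 10].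
-/

noncomputable section

namespace Summit.CriticalPhenomena.PercolationContinuityZ3.Theorems
namespace Quant
namespace LawDec
open Tab

/-- leaf check `(u,a)=(0,5)`, atoms `(0,1,5)`, mode `seg` passes. [this work] -/
theorem certR8Leaf_0_5_seg : leafChk certDataR8.ψq certDataR8.y (certDataR8.Tu 0) certDataR8.fuel 0 5 0 1 5 Mode.seg = true := by native_decide


end LawDec
end Quant
end Summit.CriticalPhenomena.PercolationContinuityZ3.Theorems
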